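import Mathlib
import Literature.MathematicalPhysics.KineticTheory.HardSphereEuler
import Literature.Analysis.FluidPDE.HardSphereCollisionRecord
import Summits.AtomisticToContinuum.HydrodynamicLimit.Theses.OneFlightGossipEngine

/-!
# Sketch — crux-ideate round 1, ideator 1, crux `EnergyCurrentTails` (stmt-AtomisticToContinuum-9235)

First lemmas of the three idea cards (statements only; `sorry` allowed at this stage):

* §1 `quartic-schur-ledger`: the exact quartic collision increment and its bilinear positive part;
  the transfer `QuarticBound` and `QuarticBound → EnergyCurrentTails` (Chebyshev).
* §2 `pedigree-perpetuity`: the packet-energy step inequality and the deterministic perpetuity bound.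
* §3 `level-census-comparison`: the up-step identity, the expected level census and the transfer
  `GaussianCensusBound → EnergyCurrentTails`.
-/

noncomputable section

open MeasureTheory Set Finset
open scoped ENNReal InnerProductSpace BigOperators

namespace Summit.AtomisticToContinuum.HydrodynamicLimit.Cruxes.EnergyCurrentTails.Sketch

open Literature.MathematicalPhysics.KineticTheory Literature.Analysis.FluidPDE

/-! ## §0 Hard-sphere pair kinematics on `V3` (the collision map in impact-vector form) -/

/-! The collision map is the tree's `Literature.Analysis.FluidPDE.reflectVel ω (v, w)
= (v − ⟪v − w, ω⟫/‖ω‖² • ω, w + ⟪v − w, ω⟫/‖ω‖² • ω)`; below `ω` is a unit impact vector. -/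

/-- Energy exchange (exact): `‖v'‖² = ‖v‖² − ⟪v,ω⟫² + ⟪w,ω⟫²` for a unit impact vector. [folklore] -/
theorem norm_sq_reflectVel_fst (v w ω : V3) (hω : ‖ω‖ = 1) :
    ‖(reflectVel ω (v, w)).1‖ ^ 2 = ‖v‖ ^ 2 - ⟪v, ω⟫_ℝ ^ 2 + ⟪w, ω⟫_ℝ ^ 2 := by
  have h1 : ‖ω‖ ^ 2 = 1 := by rw [hω]; norm_num
  have hc : ⟪v - w, ω⟫_ℝ = ⟪v, ω⟫_ℝ - ⟪w, ω⟫_ℝ := inner_sub_left _ _ _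
  simp only [reflectVel, h1, div_one]
  rw [norm_sub_sq_real, norm_smul, mul_pow, Real.norm_eq_abs, sq_abs, h1, inner_smul_right, hc]
  ring

/-- Energy exchange (exact): `‖w'‖² = ‖w‖² + ⟪v,ω⟫² − ⟪w,ω⟫²`. [folklore] -/
theorem norm_sq_reflectVel_snd (v w ω : V3) (hω : ‖ω‖ = 1) :
    ‖(reflectVel ω (v, w)).2‖ ^ 2 = ‖w‖ ^ 2 + ⟪v, ω⟫_ℝ ^ 2 - ⟪w, ω⟫_ℝ ^ 2 := by
  have h1 : ‖ω‖ ^ 2 = 1 := by rw [hω]; norm_num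
  have hc : ⟪v - w, ω⟫_ℝ = ⟪v, ω⟫_ℝ - ⟪w, ω⟫_ℝ := inner_sub_left _ _ _
  simp only [reflectVel, h1, div_one]
  rw [norm_add_sq_real, norm_smul, mul_pow, Real.norm_eq_abs, sq_abs, h1, inner_smul_right, hc]
  ring

/-! ## §1 Card `quartic-schur-ledger` -/

/-- **FIRST LEMMA (card 1). At `p = 2` Povzner is a signed identity.** For every elastic hard-sphere
collision with unit impact vector `ω`, writing `a = ⟪v,ω⟫`, `b = ⟪w,ω⟫` (so that the energy passed
from `v` to `w` is `ΔE = a² − b²`),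
`‖v'‖⁴ + ‖w'‖⁴ − ‖v‖⁴ − ‖w‖⁴ = −2 (a² − b²) ((‖v‖² − a²) − (‖w‖² − b²)) = −2·ΔE·(E₁' − E₂)`:
non-positive exactly when the collision is EQUALISING (`E₁'` lands between `E₂` and `E₁`). -/
theorem quartic_collision_identity (v w ω : V3) (hω : ‖ω‖ = 1) :
    ‖(reflectVel ω (v, w)).1‖ ^ 4 + ‖(reflectVel ω (v, w)).2‖ ^ 4 - ‖v‖ ^ 4 - ‖w‖ ^ 4
      = -2 * (⟪v, ω⟫_ℝ ^ 2 - ⟪w, ω⟫_ℝ ^ 2)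
          * ((‖v‖ ^ 2 - ⟪v, ω⟫_ℝ ^ 2) - (‖w‖ ^ 2 - ⟪w, ω⟫_ℝ ^ 2)) := by
  have e1 := norm_sq_reflectVel_fst v w ω hω
  have e2 := norm_sq_reflectVel_snd v w ω hω
  have p1 : ‖(reflectVel ω (v, w)).1‖ ^ 4 = (‖(reflectVel ω (v, w)).1‖ ^ 2) ^ 2 := by ring
  have p2 : ‖(reflectVel ω (v, w)).2‖ ^ 4 = (‖(reflectVel ω (v, w)).2‖ ^ 2) ^ 2 := by ring
  have p3 : ‖v‖ ^ 4 = (‖v‖ ^ 2) ^ 2 := by ring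
  have p4 : ‖w‖ ^ 4 = (‖w‖ ^ 2) ^ 2 := by ring
  rw [p1, p2, p3, p4, e1, e2]
  ring

/-- **Bilinear gain ceiling (pointwise in `ω`).** The positive part of the quartic increment is at
most `2‖v‖²‖w‖²` — quadratic, never quartic, in the faster partner — for EVERY impact geometry. -/
theorem quartic_collision_gain_le (v w ω : V3) (hω : ‖ω‖ = 1) :
    ‖(reflectVel ω (v, w)).1‖ ^ 4 + ‖(reflectVel ω (v, w)).2‖ ^ 4 - ‖v‖ ^ 4 - ‖w‖ ^ 4
      ≤ 2 * ‖v‖ ^ 2 * ‖w‖ ^ 2 := by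
  rw [quartic_collision_identity v w ω hω]
  have ha : ⟪v, ω⟫_ℝ ^ 2 ≤ ‖v‖ ^ 2 := by
    have h := abs_real_inner_le_norm v ω
    rw [hω, mul_one] at h
    nlinarith [abs_nonneg ⟪v, ω⟫_ℝ, sq_abs ⟪v, ω⟫_ℝ]
  have hb : ⟪w, ω⟫_ℝ ^ 2 ≤ ‖w‖ ^ 2 := by
    have h := abs_real_inner_le_norm w ω
    rw [hω, mul_one] at h
    nlinarith [abs_nonneg ⟪w, ω⟫_ℝ, sq_abs ⟪w, ω⟫_ℝ]
  nlinarith [mul_nonneg (sub_nonneg.2 ha) (sub_nonneg.2 hb),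
    mul_nonneg (sq_nonneg ⟪v, ω⟫_ℝ) (sq_nonneg ⟪w, ω⟫_ℝ),
    mul_nonneg (sq_nonneg ⟪v, ω⟫_ℝ) (sub_nonneg.2 ha),
    mul_nonneg (sq_nonneg ⟪w, ω⟫_ℝ) (sub_nonneg.2 hb)]

/-- **Equalising collisions dissipate the quartic functional** (corollary of the identity). -/
theorem quartic_collision_nonpos_of_equalising (v w ω : V3) (hω : ‖ω‖ = 1)
    (h₁ : ‖w‖ ^ 2 ≤ ‖(reflectVel ω (v, w)).1‖ ^ 2) (h₂ : ‖(reflectVel ω (v, w)).1‖ ^ 2 ≤ ‖v‖ ^ 2) :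
    ‖(reflectVel ω (v, w)).1‖ ^ 4 + ‖(reflectVel ω (v, w)).2‖ ^ 4 - ‖v‖ ^ 4 - ‖w‖ ^ 4 ≤ 0 := by
  rw [quartic_collision_identity v w ω hω]
  rw [norm_sq_reflectVel_fst v w ω hω] at h₁ h₂
  have hD : 0 ≤ ⟪v, ω⟫_ℝ ^ 2 - ⟪w, ω⟫_ℝ ^ 2 := by linarith
  have hS : 0 ≤ (‖v‖ ^ 2 - ⟪v, ω⟫_ℝ ^ 2) - (‖w‖ ^ 2 - ⟪w, ω⟫_ℝ ^ 2) := by linarith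
  nlinarith [mul_nonneg hD hS]

/-- The expected empirical quartic moment along the flow at time `s`:
`E_{λ^N}[(N+1)⁻¹ Σᵢ ‖vᵢ(Φ_N(s) z)‖⁴]` (an extended non-negative real). -/
def quarticMoment (σ : ℝ) (a₀ θ₀ : T3 → ℝ) (u₀ : T3 → V3) (N : ℕ)
    (Φ : HardSphereFlow (Torus.geometry (Fin 3)) (hsDiameter σ N) (N + 1)) (s : ℝ) : ℝ≥0∞ :=
  ∫⁻ z, ENNReal.ofReal (((N : ℝ) + 1)⁻¹ * ∑ i : Fin (N + 1), ‖(Φ.flow s z i).2‖ ^ 4)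
    ∂(localGibbsLaw σ a₀ u₀ θ₀ N Φ)

/-- **TRANSFER `C⁺` of card 1: an `N`-uniform quartic bound before the first shock** (same prefix as
the crux; `K` may depend on everything before `N`). -/
def QuarticBound : Prop :=
  ∀ (a₀ θ₀ : T3 → ℝ) (u₀ : T3 → V3), Continuous a₀ → Continuous θ₀ → Continuous u₀ →
    (∀ x, 0 < a₀ x) → (∀ x, 0 < θ₀ x) → ∃ σ₀ : ℝ, 0 < σ₀ ∧ ∀ σ : ℝ, 0 < σ → σ < σ₀ →
    ∀ (T : ℝ) (ρ θ : ℝ → T3 → ℝ) (u : ℝ → T3 → V3), IsHardSphereEulerSolution σ T ρ u θ →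
    ∀ Φ : (N : ℕ) → HardSphereFlow (Torus.geometry (Fin 3)) (hsDiameter σ N) (N + 1),
      TendstoHydroFieldsAt (fun N => localGibbsLaw σ a₀ u₀ θ₀ N (Φ N)) Φ ρ u θ 0 →
      ∀ t ∈ Set.Ico 0 T, ∃ K : ℝ, ∃ N₀ : ℕ, ∀ N : ℕ, N₀ ≤ N → ∀ s ∈ Set.Icc 0 t,
        quarticMoment σ a₀ θ₀ u₀ N (Φ N) s ≤ ENNReal.ofReal K

/-- Chebyshev at the level of one configuration: `‖v‖³ 1{M < ‖v‖} ≤ ‖v‖⁴ / M` for `M > 0`. -/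
theorem cubicTail_le_quartic_div {M : ℝ} (hM : 0 < M) (v : V3) :
    Set.indicator {v : V3 | M < ‖v‖} (fun v => ‖v‖ ^ 3) v ≤ ‖v‖ ^ 4 / M := by
  by_cases hv : M < ‖v‖
  · rw [Set.indicator_of_mem (show v ∈ {v : V3 | M < ‖v‖} from hv), le_div_iff₀ hM]
    calc ‖v‖ ^ 3 * M ≤ ‖v‖ ^ 3 * ‖v‖ := mul_le_mul_of_nonneg_left hv.le (by positivity)
      _ = ‖v‖ ^ 4 := by ring
  · rw [Set.indicator_of_notMem (show v ∉ {v : V3 | M < ‖v‖} from hv)]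
    positivity

/-- **`C⁺ → C`**: the quartic bound implies the crux `EnergyCurrentTails` of the route file
(choose `M = K/ε`; Chebyshev under the integral). Provable now. -/
theorem energyCurrentTails_of_quarticBound (h : QuarticBound) :
    Summit.AtomisticToContinuum.HydrodynamicLimit.Theses.OneFlightGossipEngine.EnergyCurrentTails := by
  sorry

/-- **Pathwise telescoping of the quartic functional over the collision records** (bookkeeping stub
of card 1, over the tree's `collisionSum`; the factor `1/2` because `contactPairs` lists both
orderings): for a hard-sphere trajectory and `a ≤ b`,
`Σᵢ‖vᵢ(b)‖⁴ − Σᵢ‖vᵢ(a)‖⁴ = ½ Σ_{records in (a,b]} [‖v₁⁺‖⁴ + ‖v₂⁺‖⁴ − ‖v₁⁻‖⁴ − ‖v₂⁻‖⁴]`. -/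
theorem quartic_telescoping {N : ℕ} {ε : ℝ} {γ : ℝ → Config N (Fin 3) T3}
    (hγ : IsHardSphereTrajectory (Torus.geometry (Fin 3)) ε N γ) {a b : ℝ} (hab : a ≤ b) :
    (∑ i, ‖(γ b i).2‖ ^ 4) - (∑ i, ‖(γ a i).2‖ ^ 4)
      = (1 / 2 : ℝ) * collisionSum (Torus.geometry (Fin 3)) ε γ (Set.Ioc a b)
          (fun c => ‖c.postVel.1‖ ^ 4 + ‖c.postVel.2‖ ^ 4 - ‖c.preVel.1‖ ^ 4 - ‖c.preVel.2‖ ^ 4) := by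
  sorry

/-! ## §2 Card `pedigree-perpetuity` -/

/-- **FIRST LEMMA (card 2). The packet-energy step.** Whoever carries the larger energy after the
collision carries at most `max(1 − c, c)·‖v‖² + ‖w‖²`, `c = ⟪v,ω⟫²/‖v‖²` the projectile's squared
direction cosine: a `δ`-SPLITTING geometry (`c ∈ [δ, 1−δ]`) contracts the packet by `1 − δ`, any
geometry adds at most the partner's energy. -/
theorem packet_energy_step (v w ω : V3) (hω : ‖ω‖ = 1) (hv : v ≠ 0) :
    max (‖(reflectVel ω (v, w)).1‖ ^ 2) (‖(reflectVel ω (v, w)).2‖ ^ 2)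
      ≤ max (1 - ⟪v, ω⟫_ℝ ^ 2 / ‖v‖ ^ 2) (⟪v, ω⟫_ℝ ^ 2 / ‖v‖ ^ 2) * ‖v‖ ^ 2 + ‖w‖ ^ 2 := by
  have hv2 : 0 < ‖v‖ ^ 2 := by positivity
  have hc : ⟪v, ω⟫_ℝ ^ 2 / ‖v‖ ^ 2 * ‖v‖ ^ 2 = ⟪v, ω⟫_ℝ ^ 2 := div_mul_cancel₀ _ hv2.ne'
  have hc' : (1 - ⟪v, ω⟫_ℝ ^ 2 / ‖v‖ ^ 2) * ‖v‖ ^ 2 = ‖v‖ ^ 2 - ⟪v, ω⟫_ℝ ^ 2 := by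
    rw [sub_mul, one_mul, hc]
  have hb : ⟪w, ω⟫_ℝ ^ 2 ≤ ‖w‖ ^ 2 := by
    have h := abs_real_inner_le_norm w ω
    rw [hω, mul_one] at h
    nlinarith [abs_nonneg ⟪w, ω⟫_ℝ, sq_abs ⟪w, ω⟫_ℝ]
  have hm1 : (1 - ⟪v, ω⟫_ℝ ^ 2 / ‖v‖ ^ 2) * ‖v‖ ^ 2
      ≤ max (1 - ⟪v, ω⟫_ℝ ^ 2 / ‖v‖ ^ 2) (⟪v, ω⟫_ℝ ^ 2 / ‖v‖ ^ 2) * ‖v‖ ^ 2 :=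
    mul_le_mul_of_nonneg_right (le_max_left _ _) hv2.le
  have hm2 : ⟪v, ω⟫_ℝ ^ 2 / ‖v‖ ^ 2 * ‖v‖ ^ 2
      ≤ max (1 - ⟪v, ω⟫_ℝ ^ 2 / ‖v‖ ^ 2) (⟪v, ω⟫_ℝ ^ 2 / ‖v‖ ^ 2) * ‖v‖ ^ 2 :=
    mul_le_mul_of_nonneg_right (le_max_right _ _) hv2.le
  refine max_le ?_ ?_
  · rw [norm_sq_reflectVel_fst v w ω hω]
    linarith [hc', hm1]
  · rw [norm_sq_reflectVel_snd v w ω hω]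
    linarith [hc, hm2, sq_nonneg ⟪w, ω⟫_ℝ]

/-- **The deterministic perpetuity bound.** If a non-negative sequence obeys `E(k+1) ≤ (1−δ)E(k) + q`
on good steps and `E(k+1) ≤ E(k) + q` on bad steps, with `E 0 ≤ q`, then
`E n ≤ q · Σ_{k ≤ n} (1−δ)^{#good steps in [k, n)}`: energy absorbed long ago has been dissipated by
the good steps since. (Provable now by induction on `n`.) -/
theorem perpetuity_bound {δ q : ℝ} (hδ1 : δ ≤ 1) (E : ℕ → ℝ)
    (good : ℕ → Prop) [DecidablePred good] (h0 : E 0 ≤ q)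
    (hgood : ∀ k, good k → E (k + 1) ≤ (1 - δ) * E k + q)
    (hbad : ∀ k, ¬ good k → E (k + 1) ≤ E k + q) (n : ℕ) :
    E n ≤ q * ∑ k ∈ range (n + 1), (1 - δ) ^ ((Finset.Ico k n).filter (fun j => good j)).card := by
  induction n with
  | zero => simpa using h0
  | succ n ih =>
    have hr : 0 ≤ 1 - δ := by linarith
    -- split off the last term `k = n + 1`, whose exponent is `0`
    rw [Finset.sum_range_succ]
    have hlast : ((Finset.Ico (n + 1) (n + 1)).filter (fun j => good j)).card = 0 := by simp
    rw [hlast, pow_zero]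
    -- relate the exponents at horizon `n + 1` to those at horizon `n`
    have hIco : ∀ k ∈ range (n + 1), Finset.Ico k (n + 1) = insert n (Finset.Ico k n) := by
      intro k hk
      rw [Finset.mem_range] at hk
      exact Nat.Ico_succ_right_eq_insert_Ico (by omega)
    have hnot : ∀ k, n ∉ Finset.Ico k n := by intro k; simp
    by_cases hg : good n
    · have hsum : ∑ k ∈ range (n + 1), (1 - δ) ^ ((Finset.Ico k (n + 1)).filter (fun j => good j)).card
          = (1 - δ) * ∑ k ∈ range (n + 1), (1 - δ) ^ ((Finset.Ico k n).filter (fun j => good j)).card := by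
        rw [Finset.mul_sum]
        refine Finset.sum_congr rfl fun k hk => ?_
        rw [hIco k hk, Finset.filter_insert, if_pos hg, Finset.card_insert_of_notMem, pow_succ]
        · ring
        · simp
      rw [hsum]
      have := hgood n hg
      have hS : 0 ≤ ∑ k ∈ range (n + 1), (1 - δ) ^ ((Finset.Ico k n).filter (fun j => good j)).card :=
        Finset.sum_nonneg fun k _ => pow_nonneg hr _
      nlinarith [mul_le_mul_of_nonneg_left ih hr]
    · have hsum : ∑ k ∈ range (n + 1), (1 - δ) ^ ((Finset.Ico k (n + 1)).filter (fun j => good j)).card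
          = ∑ k ∈ range (n + 1), (1 - δ) ^ ((Finset.Ico k n).filter (fun j => good j)).card := by
        refine Finset.sum_congr rfl fun k hk => ?_
        rw [hIco k hk, Finset.filter_insert, if_neg hg]
      rw [hsum]
      have := hbad n hg
      nlinarith [ih]

/-! ## §3 Card `level-census-comparison` -/

/-- **FIRST LEMMA (card 3). Up-steps are bounded by the partner's NORMAL energy, down-steps are
proportional**: `‖v'‖² − ‖v‖² = ⟪w,ω⟫² − ⟪v,ω⟫² ≤ ⟪w,ω⟫² ≤ ‖w‖²` (a thermal partner lifts a fast
particle by at most a thermal quantum, whatever the geometry). -/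
theorem upStep_le_partner_normal_energy (v w ω : V3) (hω : ‖ω‖ = 1) :
    ‖(reflectVel ω (v, w)).1‖ ^ 2 - ‖v‖ ^ 2 ≤ ⟪w, ω⟫_ℝ ^ 2 ∧ ⟪w, ω⟫_ℝ ^ 2 ≤ ‖w‖ ^ 2 := by
  refine ⟨?_, ?_⟩
  · rw [norm_sq_reflectVel_fst v w ω hω]
    nlinarith [sq_nonneg ⟪v, ω⟫_ℝ]
  · have h := abs_real_inner_le_norm w ω
    rw [hω, mul_one] at h
    nlinarith [abs_nonneg ⟪w, ω⟫_ℝ, sq_abs ⟪w, ω⟫_ℝ]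

/-- The expected LEVEL CENSUS along the flow: `n_s(E) = E_{λ^N} #{i : ‖vᵢ(Φ_N(s) z)‖² > E}`. -/
def levelCensus (σ : ℝ) (a₀ θ₀ : T3 → ℝ) (u₀ : T3 → V3) (N : ℕ)
    (Φ : HardSphereFlow (Torus.geometry (Fin 3)) (hsDiameter σ N) (N + 1)) (s E : ℝ) : ℝ≥0∞ :=
  ∫⁻ z, (∑ i : Fin (N + 1), Set.indicator {v : V3 | E < ‖v‖ ^ 2} (fun _ => (1 : ℝ≥0∞)) ((Φ.flow s z i).2))
    ∂(localGibbsLaw σ a₀ u₀ θ₀ N Φ)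

/-- **TRANSFER `C⁺` of card 3 = Nachtergaele–Yau's cutoff II.1 in census (expectation) form**: an
exponential-in-energy bound on the expected level census, pointwise in `s`, uniformly in `N`. -/
def GaussianCensusBound : Prop :=
  ∀ (a₀ θ₀ : T3 → ℝ) (u₀ : T3 → V3), Continuous a₀ → Continuous θ₀ → Continuous u₀ →
    (∀ x, 0 < a₀ x) → (∀ x, 0 < θ₀ x) → ∃ σ₀ : ℝ, 0 < σ₀ ∧ ∀ σ : ℝ, 0 < σ → σ < σ₀ →
    ∀ (T : ℝ) (ρ θ : ℝ → T3 → ℝ) (u : ℝ → T3 → V3), IsHardSphereEulerSolution σ T ρ u θ →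
    ∀ Φ : (N : ℕ) → HardSphereFlow (Torus.geometry (Fin 3)) (hsDiameter σ N) (N + 1),
      TendstoHydroFieldsAt (fun N => localGibbsLaw σ a₀ u₀ θ₀ N (Φ N)) Φ ρ u θ 0 →
      ∀ t ∈ Set.Ico 0 T, ∃ α : ℝ, 0 < α ∧ ∃ B E₀ : ℝ, ∃ N₀ : ℕ, ∀ N : ℕ, N₀ ≤ N → ∀ s ∈ Set.Icc 0 t,
        ∀ E : ℝ, E₀ ≤ E →
          levelCensus σ a₀ θ₀ u₀ N (Φ N) s E ≤ ENNReal.ofReal (B * ((N : ℝ) + 1) * Real.exp (-α * E))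

/-- **`C⁺ → C`** for card 3: layer-cake, `E[(N+1)⁻¹Σ‖v‖³1{‖v‖>M}] = (N+1)⁻¹∫ n_s d(r³)` over
`r > M`, and an exponential census is summable against `r²`. Provable now (layer-cake + dominated
tails). -/
theorem energyCurrentTails_of_gaussianCensusBound (h : GaussianCensusBound) :
    Summit.AtomisticToContinuum.HydrodynamicLimit.Theses.OneFlightGossipEngine.EnergyCurrentTails := by
  sorry

/-- **The comparison lemma of card 3, discrete-window form** (pure real analysis, PROVED by induction on
the window index; the scheme is COOPERATIVE: the right-hand side is non-decreasing in `n k E`, in the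
lower level `n k (E − Δ)` and in the upper level `n k (2E)` as soon as `C + c ≤ 1`).
If level counts `n : ℕ → ℝ → ℝ` (window index, level), a priori bounded by `Ntot` on the boundary band
and above (`Ntot` is NOT the particle number: in the application it is the Chebyshev/energy bound
`N·m₂/(E₀ − Δ)`, valid at all times by conservation of energy), satisfy for `E ≥ E₀`
`n (k+1) E ≤ n k E + C·(n k (E − Δ) − n k E) − c·(n k E − n k (2E))` (bounded up-steps feed level
`E` only from the band below it; proportional down-steps empty `[E, 2E]` at rate `c`), then every
exponential profile `B·Ntot·e^{−αE}` that dominates the data, exceeds `Ntot` at `E₀`, and satisfies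
the supersolution inequality `C(e^{αΔ} − 1) ≤ c(1 − e^{−αE₀})` dominates `n k` for ALL `k`:
the number of windows (the collision clock `ν_N`) never enters. The fast–fast MERGE source
`+ A·n k (E/2)²/Ntot'` is quadratic in the census; crux-plan carries it as a perturbation of the
decay term, small because the Chebyshev normalisation makes the census prefactor `≍ m₂/E₀`. -/
theorem census_comparison {C c Δ E₀ α B Ntot : ℝ} (hC : 0 ≤ C) (hc : 0 ≤ c) (hCc : C + c ≤ 1)
    (hα : 0 ≤ α) (hE₀ : 0 ≤ E₀) (hN : 0 ≤ Ntot)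
    (n : ℕ → ℝ → ℝ) (hnN : ∀ k E, E₀ - Δ ≤ E → n k E ≤ Ntot)
    (hstep : ∀ k E, E₀ ≤ E →
      n (k + 1) E ≤ n k E + C * (n k (E - Δ) - n k E) - c * (n k E - n k (2 * E)))
    (hsuper : C * (Real.exp (α * Δ) - 1) ≤ c * (1 - Real.exp (-α * E₀)))
    (hbdry : 1 ≤ B * Real.exp (-α * E₀))
    (hinit : ∀ E, E₀ ≤ E → n 0 E ≤ B * Ntot * Real.exp (-α * E)) :
    ∀ k E, E₀ ≤ E → n k E ≤ B * Ntot * Real.exp (-α * E) := by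
  have hB : 0 ≤ B := by
    have hpos : 0 < Real.exp (-α * E₀) := Real.exp_pos _
    by_contra hneg
    push Not at hneg
    have : B * Real.exp (-α * E₀) ≤ 0 := mul_nonpos_of_nonpos_of_nonneg hneg.le hpos.le
    linarith
  intro k
  induction k with
  | zero => intro E hE; exact hinit E hE
  | succ k ih =>
    intro E hE
    -- the barrier at level `E`
    set b : ℝ := B * Ntot * Real.exp (-α * E) with hb_def
    have hb0 : 0 ≤ b := by rw [hb_def]; positivity
    -- levels below `E₀` are dominated through the boundary condition
    have hlow : ∀ E', E₀ - Δ ≤ E' → n k E' ≤ B * Ntot * Real.exp (-α * E') := by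
      intro E' _hE'
      by_cases h' : E₀ ≤ E'
      · exact ih E' h'
      · push Not at h'
        have h1 : Real.exp (-α * E₀) ≤ Real.exp (-α * E') := Real.exp_le_exp.2 (by nlinarith)
        calc n k E' ≤ Ntot := hnN k E' _hE'
          _ = 1 * Ntot := by ring
          _ ≤ (B * Real.exp (-α * E₀)) * Ntot := mul_le_mul_of_nonneg_right hbdry hN
          _ ≤ (B * Real.exp (-α * E')) * Ntot :=
              mul_le_mul_of_nonneg_right (mul_le_mul_of_nonneg_left h1 hB) hN
          _ = B * Ntot * Real.exp (-α * E') := by ring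
    -- the three inputs of the step, each dominated by the barrier
    have h₁ : n k E ≤ b := ih E hE
    have h₂ : n k (E - Δ) ≤ b * Real.exp (α * Δ) := by
      have := hlow (E - Δ) (by linarith)
      have hexp : Real.exp (-α * (E - Δ)) = Real.exp (-α * E) * Real.exp (α * Δ) := by
        rw [← Real.exp_add]; ring_nf
      rw [hexp] at this
      calc n k (E - Δ) ≤ B * Ntot * (Real.exp (-α * E) * Real.exp (α * Δ)) := this
        _ = b * Real.exp (α * Δ) := by rw [hb_def]; ring
    have h₃ : n k (2 * E) ≤ b * Real.exp (-α * E₀) := by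
      have := ih (2 * E) (by linarith)
      have hexp : Real.exp (-α * (2 * E)) = Real.exp (-α * E) * Real.exp (-α * E) := by
        rw [← Real.exp_add]; ring_nf
      have hmono : Real.exp (-α * E) ≤ Real.exp (-α * E₀) := Real.exp_le_exp.2 (by nlinarith)
      rw [hexp] at this
      calc n k (2 * E) ≤ B * Ntot * (Real.exp (-α * E) * Real.exp (-α * E)) := this
        _ = b * Real.exp (-α * E) := by rw [hb_def]; ring
        _ ≤ b * Real.exp (-α * E₀) := mul_le_mul_of_nonneg_left hmono hb0
    -- the step, rearranged as a convex-type combination with non-negative weights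
    have hst := hstep k E hE
    have hw : n (k + 1) E ≤ (1 - C - c) * n k E + C * n k (E - Δ) + c * n k (2 * E) := by
      linarith
    have hw' : (1 - C - c) * n k E + C * n k (E - Δ) + c * n k (2 * E)
        ≤ (1 - C - c) * b + C * (b * Real.exp (α * Δ)) + c * (b * Real.exp (-α * E₀)) := by
      have w0 : 0 ≤ 1 - C - c := by linarith
      nlinarith [mul_le_mul_of_nonneg_left h₁ w0, mul_le_mul_of_nonneg_left h₂ hC,
        mul_le_mul_of_nonneg_left h₃ hc]
    -- supersolution inequality
    have hfin : (1 - C - c) * b + C * (b * Real.exp (α * Δ)) + c * (b * Real.exp (-α * E₀)) ≤ b := by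
      have : (1 - C - c) * b + C * (b * Real.exp (α * Δ)) + c * (b * Real.exp (-α * E₀))
          = b * (1 + (C * (Real.exp (α * Δ) - 1) - c * (1 - Real.exp (-α * E₀)))) := by ring
      rw [this]
      have hneg : C * (Real.exp (α * Δ) - 1) - c * (1 - Real.exp (-α * E₀)) ≤ 0 := by linarith
      nlinarith [mul_le_mul_of_nonneg_left (show 1 + (C * (Real.exp (α * Δ) - 1)
        - c * (1 - Real.exp (-α * E₀))) ≤ 1 by linarith) hb0]
    linarith

end Summit.AtomisticToContinuum.HydrodynamicLimit.Cruxes.EnergyCurrentTails.Sketch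

end
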